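import Literature.MathematicalPhysics.QuantumLattice.QuantumSpinChessboardEstimate
import HarnessLib

/-!
# The quantum chessboard estimate with cubes as basic elements (FILS 1978 Thm. 4.3;
# Fröhlich–Lieb 1978, eqs. (1.35)–(1.42): two-site elements `Pᵢ⁺Pⱼ⁻`)

Topic `MathematicalPhysics/QuantumLattice`; continuation of `QuantumSpinChessboardEstimate.lean`
(one-site basic elements, reflections between all sites), carrying out its `TODO(general form)`:
the torus `(ℤ/Nbℤ)^d` is partitioned into the `N^d` disjoint cubes of side `b`, reflection
positivity is used ONLY through the planes between the cubes, and the basic elements of the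
chessboard estimate are observables of a whole cube — here products of single-site observables over
the cube (a "pattern"; Fröhlich–Lieb's two-site element `Pᵢ⁺Pⱼ⁻` on a nearest-neighbour pair is the
case `b = 2`), which is what the Peierls–chessboard argument consumes (FL §I.D: the contour bonds of
one class are disjoint pairs inside disjoint dimers; the chessboard estimate spreads the pattern
`(P⁺, P⁻)` over all dimers with alternating mirror images, giving the universal projection `P_Λ` of
FL (1.35), `+ - - + + - - + …`).

* `blockScale`, `blockSite`, `chessboardBlockEquiv`, `blockOf`, `offsetOf` — block coordinates
  `(ℤ/Nℤ)^d × {0,…,b-1}^d ≃ (ℤ/Nbℤ)^d`, `(c, o) ↦ b c + o`;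
* `blockPlane k` (`= b k - 1`): the planes between the cubes are the tree's planes between the sites
  `xᵢ = bk - 1`, `bk`; `reflectBetweenSites_blockSite`: the reflection acts as
  (block reflection `cellReflect`) × (mirror of the offset); `mem_torusLeftHalf_blockPlane_iff`: the
  left half-torus consists of the cubes of the positive half `halfPlus` of the block torus;
* **`chessboard_estimate_blocks_of_covariant`** (FILS Thm. 4.3, quantum case): for an exponent `K`
  reflection positive across the planes between the cubes (`IsRPExponent` of the one-site file at
  the planes `blockPlane k`), block labels `τ : (ℤ/Nℤ)^d → ι` and a placement `g` of single-site
  observables covariant under those reflections,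
  `|Re Tr[(⨂_x g_x(τ_{block x})) e^K]|^{N^d} ≤ ∏_{cubes c} Re Tr[(⨂_y g_y(τ_c)) e^K]` — the tree's
  abstract `chessboard_abs_pow_le_prod_const` on the block torus, with the Schwarz inequality of the
  one-site file along the planes between cubes;
* `mirroredOffset`, `chessboard_estimate_blocks_real`: REAL patterns `p_lbl : {0,…,b-1}^d → M_q(ℂ)`
  placed in every cube through the offset mirrored in the directions where the block index is odd
  (FILS's `F̃_{(i)}` = "a translate of `F` reflected in `ν₀` orthogonal planes"; FL's `P_Λ`);
  `chessboard_estimate_blocks_gibbs_real` (Gibbs state), `xyzReal_chessboard_estimate_blocks`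
  (the Björnberg–Ueltschi / rotated XXZ–XY family of the one-site file: FL (1.36)/(1.42) for their
  models (3), (6) in the rotated frame).

Scope: patterns are products of single-site observables (general cube observables would need the
product-over-cubes operator; not needed for the Peierls application); the modulus form and FL
Thm. 2.2 (2) are in the one-site file only. No named facts; no sorries.

## References

* J. Fröhlich, R. Israel, E. H. Lieb, B. Simon, *Phase transitions and reflection positivity. I*,
  Comm. Math. Phys. **62** (1978) 1–34, §4 Thm. 4.3 (Selecta pp. 207–208).
  [FrohlichIsraelLiebSimon1978]
* J. Fröhlich, E. H. Lieb, *Phase transitions in anisotropic lattice spin systems*, Comm. Math.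
  Phys. **60** (1978) 233–267, §I.D eqs. (1.35)–(1.42), §II Thm. 2.2 (Selecta pp. 243–245, 250–253).
  [FrohlichLieb1978]
* S. Friedli, Y. Velenik, *Statistical Mechanics of Lattice Systems*, CUP 2017, §10.2 (blocks
  `Λ_B + tB`), Thm. 10.11. [FriedliVelenik2017]
-/

noncomputable section

open Matrix Finset NormedSpace
open scoped Kronecker ComplexOrder BigOperators
open Literature.MathematicalPhysics.QuantumLattice Literature.Probability.LatticeModels
  Literature.Barriers.CriticalPhenomena.NonGibbs

namespace Literature.MathematicalPhysics.QuantumLattice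

/-- The real part of a Gibbs expectation of a Hermitian Hamiltonian: `Re⟨X⟩ = Re Tr[X e^{-βH}]/Z`.
[folklore] -/
private theorem blocksAux_re_gibbsState {d : ℕ} (L : ℕ) [NeZero L] {n : ℕ}
    {H : Op (TorusSite d L) (n + 1)} (hH : H.IsHermitian) (β : ℝ) (X : Op (TorusSite d L) (n + 1)) :
    (Matrix.gibbsState β H X).re =
      ((partitionFn β H).re)⁻¹ * (X * exp (-(β : ℂ) • H)).trace.re := by
  haveI : Nonempty (TensorIndex (TorusSite d L) (n + 1)) := ⟨fun _ => 0⟩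
  obtain ⟨-, hZeq⟩ := Matrix.partitionFn_re_pos β hH
  rw [Matrix.gibbsState_apply, hZeq, ← Complex.ofReal_inv, Complex.re_ofReal_mul, gibbsWeight,
    Matrix.trace_mul_comm, Complex.ofReal_re]

/-! ### Blocks: FILS Thm. 4.3 / Fröhlich–Lieb's two-site basic elements -/

section Blocks

variable {d : ℕ} (N b : ℕ) [NeZero N] [NeZero b]

/-- Multiplication by the block side `b`: `ℤ/Nℤ → ℤ/(Nb)ℤ`, `v ↦ b·v` (well defined since
`b·N = 0` in `ℤ/(Nb)ℤ`); the lower corner of the block with index `v` along one axis.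
[cite: FriedliVelenik2017, §10.2] -/
def blockScale : ZMod N →+ ZMod (N * b) :=
  ZMod.lift N ⟨(b : ℤ) • Int.castAddHom (ZMod (N * b)), by
    show (b : ℤ) • (((N : ℕ) : ℤ) : ZMod (N * b)) = 0
    rw [zsmul_eq_mul, Int.cast_natCast, Int.cast_natCast, ← Nat.cast_mul, Nat.mul_comm b N]
    exact ZMod.natCast_self (N * b)⟩

omit [NeZero b] in
/-- `b·v` is the class of the natural number `b · v.val`. [cite: FriedliVelenik2017, §10.2] -/
theorem blockScale_apply (v : ZMod N) :
    blockScale N b v = ((b * v.val : ℕ) : ZMod (N * b)) := by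
  conv_lhs => rw [← ZMod.natCast_zmod_val v, ← Int.cast_natCast]
  rw [blockScale, ZMod.lift_coe]
  simp only [AddMonoidHom.smul_apply, Int.coe_castAddHom, zsmul_eq_mul, Int.cast_natCast]
  push_cast
  ring

omit [NeZero N] [NeZero b] in
/-- `b·1 = b`. [cite: FriedliVelenik2017, §10.2] -/
theorem blockScale_one (hN : 1 < N) : blockScale N b 1 = (b : ZMod (N * b)) := by
  haveI : Fact (1 < N) := ⟨hN⟩
  rw [blockScale_apply, ZMod.val_one, mul_one]

/-- **The sites of a block**: the site of `(ℤ/Nbℤ)^d` with block index `c ∈ (ℤ/Nℤ)^d` and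
offset `o ∈ {0,…,b-1}^d`, `xᵢ = b cᵢ + oᵢ` (the blocks `Λ_B + tB` of Friedli–Velenik §10.2 / FILS
Thm. 4.3's cubes, here disjoint cubes of side `b` between the reflection planes).
[cite: FriedliVelenik2017, §10.2] -/
def blockSite (p : BlockIdx d N × (Fin d → Fin b)) : TorusSite d (N * b) :=
  fun i => blockScale N b (p.1 i) + ((p.2 i : ℕ) : ZMod (N * b))

omit [NeZero b] in
/-- The coordinates of a block site: `(b cᵢ + oᵢ).val = b cᵢ.val + oᵢ` (the sites of the
block `Λ_B + tB`). [cite: FriedliVelenik2017, §10.2] -/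
theorem val_blockSite (p : BlockIdx d N × (Fin d → Fin b)) (i : Fin d) :
    (blockSite N b p i).val = b * (p.1 i).val + (p.2 i : ℕ) := by
  have hlt : b * (p.1 i).val + (p.2 i : ℕ) < N * b := by
    have h1 : (p.1 i).val + 1 ≤ N := ZMod.val_lt _
    have h2 : (p.2 i : ℕ) < b := (p.2 i).isLt
    nlinarith
  rw [blockSite, blockScale_apply, ← Nat.cast_add, ZMod.val_cast_of_lt hlt]

/-- `(c, o) ↦ b c + o` is injective (the blocks partition the torus).
[cite: FriedliVelenik2017, §10.2] -/
theorem chessboardBlockSite_injective : Function.Injective (blockSite (d := d) N b) := by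
  intro p p' h
  have hb : 0 < b := Nat.pos_of_ne_zero (NeZero.ne b)
  have hc : ∀ i, (p.1 i).val = (p'.1 i).val ∧ (p.2 i : ℕ) = (p'.2 i : ℕ) := by
    intro i
    have hi := congrArg (fun x : TorusSite d (N * b) => (x i).val) h
    simp only [val_blockSite] at hi
    have hdiv := congrArg (· / b) hi
    have hmod := congrArg (· % b) hi
    simp only [Nat.mul_add_div hb, Nat.div_eq_of_lt (p.2 i).isLt, Nat.div_eq_of_lt (p'.2 i).isLt,
      add_zero, Nat.mul_add_mod, Nat.mod_eq_of_lt (p.2 i).isLt, Nat.mod_eq_of_lt (p'.2 i).isLt]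
      at hdiv hmod
    exact ⟨hdiv, hmod⟩
  refine Prod.ext (funext fun i => ZMod.val_injective N (hc i).1) (funext fun i => Fin.ext (hc i).2)

/-- **Block coordinates**: `(ℤ/Nℤ)^d × {0,…,b-1}^d ≃ (ℤ/Nbℤ)^d`, `(c, o) ↦ b c + o`.
[cite: FriedliVelenik2017, §10.2] -/
def chessboardBlockEquiv : BlockIdx d N × (Fin d → Fin b) ≃ TorusSite d (N * b) :=
  Equiv.ofBijective (blockSite N b) <| by
    rw [Fintype.bijective_iff_injective_and_card]
    refine ⟨chessboardBlockSite_injective N b, ?_⟩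
    simp only [Fintype.card_prod, Fintype.card_pi, prod_const, card_univ, ZMod.card,
      Fintype.card_fin, mul_pow]

/-- The block index of a site. [cite: FriedliVelenik2017, §10.2] -/
def blockOf (x : TorusSite d (N * b)) : BlockIdx d N := ((chessboardBlockEquiv N b).symm x).1

/-- The offset of a site inside its block. [cite: FriedliVelenik2017, §10.2] -/
def offsetOf (x : TorusSite d (N * b)) : Fin d → Fin b := ((chessboardBlockEquiv N b).symm x).2

/-- `blockOf (b c + o) = c`. [cite: FriedliVelenik2017, §10.2] -/
@[simp] theorem blockOf_blockSite (p : BlockIdx d N × (Fin d → Fin b)) :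
    blockOf N b (blockSite N b p) = p.1 := by
  rw [blockOf, show blockSite N b p = chessboardBlockEquiv N b p from rfl, Equiv.symm_apply_apply]

/-- `offsetOf (b c + o) = o`. [cite: FriedliVelenik2017, §10.2] -/
@[simp] theorem offsetOf_blockSite (p : BlockIdx d N × (Fin d → Fin b)) :
    offsetOf N b (blockSite N b p) = p.2 := by
  rw [offsetOf, show blockSite N b p = chessboardBlockEquiv N b p from rfl, Equiv.symm_apply_apply]

/-- Every site is `b · blockOf + offsetOf` (the blocks cover the torus).
[cite: FriedliVelenik2017, §10.2] -/
theorem blockSite_blockOf_offsetOf (x : TorusSite d (N * b)) :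
    blockSite N b (blockOf N b x, offsetOf N b x) = x :=
  (chessboardBlockEquiv N b).apply_symm_apply x

/-- **The reflection planes between blocks**: the planes between the sites `xᵢ = bk - 1` and
`xᵢ = bk` (and their antipodes), i.e. the tree's `Torus.reflectBetweenSites i (blockPlane k)` with
`blockPlane k + 1 = b k`. [cite: FrohlichIsraelLiebSimon1978, Thm. 4.3] -/
def blockPlane (k : ZMod N) : ZMod (N * b) := blockScale N b k - 1

/-- The mirror image of an offset in direction `i`: `oᵢ ↦ b - 1 - oᵢ`.
[cite: FrohlichIsraelLiebSimon1978, Thm. 4.3] -/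
def mirrorOffset (i : Fin d) (o : Fin d → Fin b) : Fin d → Fin b :=
  Function.update o i (Fin.rev (o i))

omit [NeZero b] in
/-- `mirrorOffset` is an involution (`θ² = 1`). [cite: FrohlichIsraelLiebSimon1978, Thm. 4.3] -/
theorem mirrorOffset_mirrorOffset (i : Fin d) (o : Fin d → Fin b) :
    mirrorOffset b i (mirrorOffset b i o) = o := by
  funext j
  by_cases h : j = i
  · subst h; simp [mirrorOffset]
  · simp [mirrorOffset, h]

omit [NeZero N] [NeZero b] in
/-- **The reflection between blocks acts on block coordinates as (block reflection) × (mirror of the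
offset)**: `θ(b c + o) = b c' + o'` with `c' = c[i ↦ 2k - 1 - cᵢ]` (`cellReflect`) and
`o' = o[i ↦ b - 1 - oᵢ]`. [cite: FrohlichIsraelLiebSimon1978, Thm. 4.3] -/
theorem reflectBetweenSites_blockSite (hN : 1 < N) (i : Fin d) (k : ZMod N)
    (p : BlockIdx d N × (Fin d → Fin b)) :
    Torus.reflectBetweenSites i (blockPlane N b k) (blockSite N b p) =
      blockSite N b (cellReflect i k p.1, mirrorOffset b i p.2) := by
  funext j
  simp only [Torus.reflectBetweenSites_apply, blockSite]
  by_cases hj : j = i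
  · subst hj
    rw [Function.update_self, cellReflect_apply, Function.update_self, mirrorOffset,
      Function.update_self, blockPlane,
      show (2 : ZMod N) * k - 1 - p.1 j = k + k - 1 - p.1 j by ring, map_sub, map_sub, map_add,
      blockScale_one N b hN, Fin.val_rev]
    have hb : (p.2 j : ℕ) + 1 ≤ b := (p.2 j).isLt
    rw [Nat.cast_sub hb]
    push_cast
    ring
  · rw [Function.update_of_ne hj, cellReflect_apply_of_ne _ _ _ hj, mirrorOffset,
      Function.update_of_ne hj, blockSite]

/-- The block of a reflected site is the reflected block.
[cite: FrohlichIsraelLiebSimon1978, Thm. 4.3] -/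
theorem blockOf_reflectBetweenSites (hN : 1 < N) (i : Fin d) (k : ZMod N)
    (x : TorusSite d (N * b)) :
    blockOf N b (Torus.reflectBetweenSites i (blockPlane N b k) x) =
      cellReflect i k (blockOf N b x) := by
  conv_lhs => rw [← blockSite_blockOf_offsetOf N b x, reflectBetweenSites_blockSite N b hN]
  rw [blockOf_blockSite]

/-- The offset of a reflected site is the mirrored offset.
[cite: FrohlichIsraelLiebSimon1978, Thm. 4.3] -/
theorem offsetOf_reflectBetweenSites (hN : 1 < N) (i : Fin d) (k : ZMod N)
    (x : TorusSite d (N * b)) :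
    offsetOf N b (Torus.reflectBetweenSites i (blockPlane N b k) x) =
      mirrorOffset b i (offsetOf N b x) := by
  conv_lhs => rw [← blockSite_blockOf_offsetOf N b x, reflectBetweenSites_blockSite N b hN]
  rw [offsetOf_blockSite]

/-- **The left half of the planes between blocks consists of whole blocks**: a site is in the left
half-torus of the planes `blockPlane k` iff its block is in the positive half `halfPlus N i k` of
the block torus (`N` even). [cite: FrohlichIsraelLiebSimon1978, Thm. 4.3] -/
theorem mem_torusLeftHalf_blockPlane_iff [NeZero (N * b)] (hN : Even N) (i : Fin d) (k : ZMod N)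
    (x : TorusSite d (N * b)) :
    x ∈ torusLeftHalf (N * b) i (blockPlane N b k) ↔ blockOf N b x ∈ halfPlus N i k := by
  have hb : 0 < b := Nat.pos_of_ne_zero (NeZero.ne b)
  obtain ⟨m, hm⟩ := hN
  conv_lhs => rw [← blockSite_blockOf_offsetOf N b x]
  set p := (blockOf N b x, offsetOf N b x) with hp
  rw [mem_torusLeftHalf, mem_halfPlus, blockPlane, sub_add_cancel]
  have hval : (blockSite N b p i - blockScale N b k).val = b * (p.1 i - k).val + (p.2 i : ℕ) := by
    have h := val_blockSite N b (p.1 - fun _ => k, p.2) i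
    simp only [blockSite, Pi.sub_apply, map_sub] at h ⊢
    rw [← h]
    congr 1
    abel
  rw [hval, show blockOf N b x = p.1 from rfl]
  have hNb : N * b / 2 = b * m := by
    rw [hm, ← two_mul, mul_assoc, Nat.mul_div_cancel_left _ two_pos, mul_comm]
  have hN2 : N / 2 = m := by rw [hm, ← two_mul, Nat.mul_div_cancel_left _ two_pos]
  rw [hNb, hN2]
  have ho : (p.2 i : ℕ) < b := (p.2 i).isLt
  constructor
  · intro h
    by_contra hc
    exact absurd h (not_lt.2 (le_trans (Nat.mul_le_mul_left b (not_lt.1 hc))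
      (Nat.le_add_right _ _)))
  · intro h
    calc b * (p.1 i - k).val + (p.2 i : ℕ) < b * (p.1 i - k).val + b := by omega
      _ = b * ((p.1 i - k).val + 1) := by ring
      _ ≤ b * m := Nat.mul_le_mul_left b h

variable {N b}
variable {q : ℕ} {ι : Type*}

/-- **The quantum chessboard estimate with `b^d`-site basic elements** (FILS I Thm. 4.3's cubes;
Fröhlich–Lieb apply Thm. 2.2 with two-site elements `Pᵢ⁺Pⱼ⁻`, (1.41)–(1.42)): on the torus
`(ℤ/Nbℤ)^d` partitioned into the `N^d` cubes of side `b` (`N` even, `d ≥ 1`), let `K` be a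
reflection-positive exponent across the planes between the cubes only, let the block labels
`τ : (ℤ/Nℤ)^d → ι` be given, and let `g : Λ → ι → M_q(ℂ)` place single-site observables covariantly
under the reflections between the cubes (`g_{θx}(lbl) = conj(g_x(lbl))`). Then
`|Re Tr[(⨂_x g_x(τ_{block x})) e^K]|^{N^d} ≤ ∏_{cubes c} Re Tr[(⨂_y g_y(τ_c)) e^K]` — on the right,
the pattern of the label `τ_c` is spread (with its mirror images, through the covariance of `g`)
over ALL cubes: Fröhlich–Lieb's universal projection `P_Λ` of (1.35) for `b = 2`, `d = 2` and the
two-site element `P⁺ ⊗ P⁻`. [cite: FrohlichIsraelLiebSimon1978, Thm. 4.3]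
[cite: FrohlichLieb1978, Thm. 2.2, eqs. (1.41)–(1.42)] -/
theorem chessboard_estimate_blocks_of_covariant [NeZero (N * b)] (hd : 0 < d) (hN : Even N)
    (hN1 : 1 < N)
    {K : Op (TorusSite d (N * b)) q}
    (hK : ∀ (i : Fin d) (k : ZMod N), IsRPExponent (N * b) i (blockPlane N b k) (hN.mul_right b) K)
    (g : TorusSite d (N * b) → ι → Matrix (Fin q) (Fin q) ℂ)
    (hg : ∀ (i : Fin d) (k : ZMod N) (x : TorusSite d (N * b)) (lbl : ι),
      g (Torus.reflectBetweenSites i (blockPlane N b k) x) lbl = (g x lbl).map (starRingEnd ℂ))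
    (τ : BlockIdx d N → ι) :
    |((productOp fun x => g x (τ (blockOf N b x))) * exp K).trace.re| ^ (N ^ d) ≤
      ∏ c, ((productOp fun y => g y (τ c)) * exp K).trace.re := by
  set hL : Even (N * b) := hN.mul_right b with hhL
  set ψ : (BlockIdx d N → ι) → ℝ := fun υ =>
    ((productOp fun x => g x (υ (blockOf N b x))) * exp K).trace.re with hψ
  have key : ∀ (i : Fin d) (k : ZMod N) (υ : BlockIdx d N → ι),
      0 ≤ ψ (asgSymP i k υ) ∧ 0 ≤ ψ (asgSymM i k υ) ∧
        ψ υ ^ 2 ≤ ψ (asgSymP i k υ) * ψ (asgSymM i k υ) := by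
    intro i k υ
    obtain ⟨κ, _, A, C, hKe⟩ := hK i k
    have hθ : ∀ x : TorusSite d (N * b),
        blockOf N b (Torus.reflectBetweenSites i (blockPlane N b k) x) =
          cellReflect i k (blockOf N b x) :=
      blockOf_reflectBetweenSites N b hN1 i k
    have hhalf : ∀ x : TorusSite d (N * b),
        blockOf N b x ∈ halfPlus N i k ↔ x ∈ torusLeftHalf (N * b) i (blockPlane N b k) := fun x =>
      (mem_torusLeftHalf_blockPlane_iff N b hN i k x).symm
    have hθθ : ∀ x : TorusSite d (N * b), Torus.reflectBetweenSites i (blockPlane N b k)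
        (Torus.reflectBetweenSites i (blockPlane N b k) x) = x :=
      fun x => Torus.reflectBetweenSites_involutive i _ x
    have hθnot : ∀ s : torusLeftHalf (N * b) i (blockPlane N b k),
        Torus.reflectBetweenSites i (blockPlane N b k) s ∉
          torusLeftHalf (N * b) i (blockPlane N b k) :=
      fun s h => (reflectBetweenSites_mem_torusLeftHalf_iff (N * b) i _ hL
        (s : TorusSite d (N * b))).1 h s.2
    have hcc : ∀ c : BlockIdx d N, cellReflect i k (cellReflect i k c) = c :=
      cellReflect_cellReflect i k
    -- the two half-torus factors
    set F : Op (torusLeftHalf (N * b) i (blockPlane N b k)) q :=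
      productOp fun s : torusLeftHalf (N * b) i (blockPlane N b k) => g s (υ (blockOf N b s))
      with hF
    set G : Op (torusLeftHalf (N * b) i (blockPlane N b k)) q :=
      productOp fun s : torusLeftHalf (N * b) i (blockPlane N b k) =>
        g (Torus.reflectBetweenSites i (blockPlane N b k) s)
          (υ (blockOf N b (Torus.reflectBetweenSites i (blockPlane N b k) s)))
      with hG
    have hτ : ψ υ = ((F ⊗ₖ G) * rpExp A C).trace.re := by
      simp only [hψ]
      rw [trace_productOp_mul_exp_eq hKe]
    have hP : ψ (asgSymP i k υ) = ((F ⊗ₖ F.map (starRingEnd ℂ)) * rpExp A C).trace.re := by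
      simp only [hψ]
      rw [trace_productOp_mul_exp_eq hKe]
      have h1 : (productOp fun s : torusLeftHalf (N * b) i (blockPlane N b k) =>
          g s (asgSymP i k υ (blockOf N b s))) = F := by
        rw [hF]
        congr 1
        funext s
        rw [asgSymP_apply_of_mem υ ((hhalf s).2 s.2)]
      have h2 : (productOp fun s : torusLeftHalf (N * b) i (blockPlane N b k) =>
          g (Torus.reflectBetweenSites i (blockPlane N b k) s)
            (asgSymP i k υ (blockOf N b (Torus.reflectBetweenSites i (blockPlane N b k) s)))) =
          F.map (starRingEnd ℂ) := by
        rw [hF, productOp_map_starRingEnd]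
        congr 1
        funext s
        rw [asgSymP_apply_of_not_mem υ (fun h => hθnot s ((hhalf _).1 h)), hθ, hcc, hg]
      rw [h1, h2]
    have hM : ψ (asgSymM i k υ) = ((G.map (starRingEnd ℂ) ⊗ₖ G) * rpExp A C).trace.re := by
      simp only [hψ]
      rw [trace_productOp_mul_exp_eq hKe]
      have h1 : (productOp fun s : torusLeftHalf (N * b) i (blockPlane N b k) =>
          g s (asgSymM i k υ (blockOf N b s))) = G.map (starRingEnd ℂ) := by
        rw [hG, productOp_map_starRingEnd]
        congr 1
        funext s
        rw [asgSymM_apply_of_not_mem υ (not_mem_halfMinus_of_mem_halfPlus ((hhalf s).2 s.2)),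
          ← hθ, ← hg i k, hθθ]
      have h2 : (productOp fun s : torusLeftHalf (N * b) i (blockPlane N b k) =>
          g (Torus.reflectBetweenSites i (blockPlane N b k) s)
            (asgSymM i k υ (blockOf N b (Torus.reflectBetweenSites i (blockPlane N b k) s)))) =
          G := by
        rw [hG]
        congr 1
        funext s
        rw [asgSymM_apply_of_mem υ
          (mem_halfMinus_of_not_mem_halfPlus (fun h => hθnot s ((hhalf _).1 h)))]
      rw [h1, h2]
    rw [hτ, hP, hM]
    refine ⟨trace_kronecker_conj_mul_rpExp_nonneg A C F, (trace_conjKronecker_mul_rpExp A G C).1,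
      ?_⟩
    calc ((F ⊗ₖ G) * rpExp A C).trace.re ^ 2
        ≤ ‖((F ⊗ₖ G) * rpExp A C).trace‖ ^ 2 := by
          rw [← sq_abs]
          exact pow_le_pow_left₀ (abs_nonneg _) (Complex.abs_re_le_norm _) 2
      _ ≤ _ := trace_kronecker_mul_rpExp_schwarz A C F G
  have h := chessboard_abs_pow_le_prod_const hd hN ψ key τ
  simp only [hψ] at h
  -- the constant assignments: `blockOf` disappears
  exact h

/-- The per-direction parity of a block index (`N` even). [cite: DLS1978, §2] -/
def blockParity (hN : Even N) (c : BlockIdx d N) (i : Fin d) : ZMod 2 :=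
  ZMod.castHom (even_iff_two_dvd.mp hN) (ZMod 2) (c i)

omit [NeZero N] in
/-- The block reflection flips the parity of the reflected coordinate and keeps the others.
[cite: FrohlichIsraelLiebSimon1978, Thm. 4.3] -/
theorem blockParity_cellReflect (hN : Even N) (i : Fin d) (k : ZMod N) (c : BlockIdx d N)
    (j : Fin d) :
    blockParity hN (cellReflect i k c) j =
      if j = i then blockParity hN c j + 1 else blockParity hN c j := by
  unfold blockParity
  by_cases hj : j = i
  · subst hj
    rw [if_pos rfl, cellReflect_apply, Function.update_self, map_sub, map_sub, map_mul, map_ofNat,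
      map_one]
    have h2 : (2 : ZMod 2) = 0 := by decide
    rw [h2, zero_mul, zero_sub, sub_eq_add_neg, ZMod.neg_eq_self_mod_two, ZMod.neg_eq_self_mod_two,
      add_comm]
  · rw [if_neg hj, cellReflect_apply_of_ne _ _ _ hj]

/-- **The mirrored offset**: the offset of a site read in the frame of its block, mirrored in every
direction in which the block index is odd — so that a pattern placed through it is tiled over the
blocks with alternating mirror images (Fröhlich–Lieb's `P_Λ`, eq. (1.35): `+ - | - + | + - …`;
FILS Thm. 4.3's `F̃_{(i)}`, "a translate of F reflected in ν₀ orthogonal planes").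
[cite: FrohlichLieb1978, eq. (1.35)] [cite: FrohlichIsraelLiebSimon1978, Thm. 4.3] -/
def mirroredOffset (hN : Even N) (x : TorusSite d (N * b)) : Fin d → Fin b :=
  fun i => if blockParity hN (blockOf N b x) i = 0 then offsetOf N b x i
    else Fin.rev (offsetOf N b x i)

/-- The mirrored offset is invariant under the reflections between blocks (the mirror of the offset
and the parity flip of the block index cancel). [cite: FrohlichIsraelLiebSimon1978, Thm. 4.3] -/
theorem mirroredOffset_reflectBetweenSites (hN : Even N) (hN1 : 1 < N) (i : Fin d) (k : ZMod N)
    (x : TorusSite d (N * b)) :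
    mirroredOffset hN (Torus.reflectBetweenSites i (blockPlane N b k) x) = mirroredOffset hN x := by
  have h01 : ∀ t : ZMod 2, t = 0 ∨ t = 1 := by decide
  funext j
  simp only [mirroredOffset, blockOf_reflectBetweenSites N b hN1,
    offsetOf_reflectBetweenSites N b hN1, blockParity_cellReflect hN]
  by_cases hj : j = i
  · subst hj
    simp only [if_true, mirrorOffset, Function.update_self]
    rcases h01 (blockParity hN (blockOf N b x) j) with h0 | h1
    · rw [h0, if_neg (by decide), if_pos rfl, Fin.rev_rev]
    · rw [h1, if_pos (by decide), if_neg (by decide)]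
  · simp only [if_neg hj, mirrorOffset, Function.update_of_ne hj]

/-- **The chessboard estimate for real patterns on blocks** (Fröhlich–Lieb (1.42) / FILS Thm. 4.3
for quantum spins): let `p : ι → ({0,…,b-1}^d → M_q(ℂ))` assign to every label a PATTERN of real
single-site matrices on the cube of side `b` (e.g. `P⁺ ⊗ P⁻` on a pair, `b = 2`), placed in each
cube through the mirrored offset. If `K` is a reflection-positive exponent across the planes
between the cubes, then for every block labelling `τ`,
`|Re Tr[(⨂_x p_{τ(block x)}(mirroredOffset x)) e^K]|^{N^d} ≤
 ∏_c Re Tr[(⨂_y p_{τ c}(mirroredOffset y)) e^K]`,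
the universal observable on the right being the pattern of `τ c` tiled over all cubes with
alternating mirror images (`P_Λ` of FL (1.35)). [cite: FrohlichLieb1978, eqs. (1.35), (1.42)]
[cite: FrohlichIsraelLiebSimon1978, Thm. 4.3] -/
theorem chessboard_estimate_blocks_real [NeZero (N * b)] (hd : 0 < d) (hN : Even N) (hN1 : 1 < N)
    {K : Op (TorusSite d (N * b)) q}
    (hK : ∀ (i : Fin d) (k : ZMod N), IsRPExponent (N * b) i (blockPlane N b k) (hN.mul_right b) K)
    (p : ι → (Fin d → Fin b) → Matrix (Fin q) (Fin q) ℂ)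
    (hp : ∀ lbl o, (p lbl o).map (starRingEnd ℂ) = p lbl o) (τ : BlockIdx d N → ι) :
    |((productOp fun x => p (τ (blockOf N b x)) (mirroredOffset hN x)) * exp K).trace.re| ^ (N ^ d)
      ≤ ∏ c, ((productOp fun y => p (τ c) (mirroredOffset hN y)) * exp K).trace.re :=
  chessboard_estimate_blocks_of_covariant hd hN hN1 hK (fun x lbl => p lbl (mirroredOffset hN x))
    (fun i k x lbl => by rw [mirroredOffset_reflectBetweenSites hN hN1, hp]) τ

/-- **Gibbs-state form of the block chessboard estimate for real patterns** (FL (1.36)/(1.42)):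
`|Re⟨⨂_x p_{τ(block x)}(mirroredOffset x)⟩_{β,H}|^{N^d} ≤ ∏_c Re⟨⨂_y p_{τ c}(mirroredOffset y)⟩`
for a Hermitian `H` on the spin torus `(ℤ/Nbℤ)^d` with `-βH` reflection positive across the planes
between the cubes. [cite: FrohlichLieb1978, eqs. (1.36), (1.42)] -/
theorem chessboard_estimate_blocks_gibbs_real [NeZero (N * b)] (hd : 0 < d) (hN : Even N)
    (hN1 : 1 < N) {n : ℕ}
    {β : ℝ} {H : Op (TorusSite d (N * b)) (n + 1)} (hH : H.IsHermitian)
    (hK : ∀ (i : Fin d) (k : ZMod N),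
      IsRPExponent (N * b) i (blockPlane N b k) (hN.mul_right b) (-(β : ℂ) • H))
    (p : ι → (Fin d → Fin b) → Matrix (Fin (n + 1)) (Fin (n + 1)) ℂ)
    (hp : ∀ lbl o, (p lbl o).map (starRingEnd ℂ) = p lbl o) (τ : BlockIdx d N → ι) :
    |(Matrix.gibbsState β H
        (productOp fun x => p (τ (blockOf N b x)) (mirroredOffset hN x))).re| ^ (N ^ d) ≤
      ∏ c, (Matrix.gibbsState β H (productOp fun y => p (τ c) (mirroredOffset hN y))).re := by
  haveI : Nonempty (TensorIndex (TorusSite d (N * b)) (n + 1)) := ⟨fun _ => 0⟩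
  have hZ := (Matrix.partitionFn_re_pos β hH).1
  have hcard : Fintype.card (BlockIdx d N) = N ^ d := by
    rw [Fintype.card_pi, prod_const, ZMod.card, card_univ, Fintype.card_fin]
  simp_rw [blocksAux_re_gibbsState (N * b) hH]
  rw [abs_mul, mul_pow, abs_inv, abs_of_pos hZ, prod_mul_distrib, prod_const, card_univ, hcard]
  exact mul_le_mul_of_nonneg_left (chessboard_estimate_blocks_real hd hN hN1 hK p hp τ)
    (pow_nonneg (inv_nonneg.2 hZ.le) _)

/-- **Fröhlich–Lieb's (1.42) for the Björnberg–Ueltschi / rotated XXZ family**: on the torus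
`(ℤ/Nbℤ)^d` (cubes of side `b`, `N` even), for every spin, all `s₁, s₂`, every `β ≥ 0`, every real
pattern family `p` and block labelling `τ`, the Gibbs state of `-Σ(s₁²S¹S¹ - s₂²S²S² + S³S³)` obeys
`|Re⟨⨂_x p_{τ(block x)}(mirroredOffset x)⟩|^{N^d} ≤ ∏_c Re⟨⨂_y p_{τ c}(mirroredOffset y)⟩` — with
`b = 2`, `d = 2`, `p = P⁺ ⊗ P⁻` on a horizontal pair this is the key estimate (1.36)/(1.42) of FL's
proof of LRO for the anisotropic quantum antiferromagnet (model (3)) and the XY model (model (6)).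
[cite: FrohlichLieb1978, eqs. (1.36), (1.42)] -/
theorem xyzReal_chessboard_estimate_blocks [NeZero (N * b)] (hd : 0 < d) (hN : Even N)
    (hN1 : 1 < N) (n : ℕ)
    (s₁ s₂ : ℝ) {β : ℝ} (hβ : 0 ≤ β)
    (p : ι → (Fin d → Fin b) → Matrix (Fin (n + 1)) (Fin (n + 1)) ℂ)
    (hp : ∀ lbl o, (p lbl o).map (starRingEnd ℂ) = p lbl o) (τ : BlockIdx d N → ι) :
    |(Matrix.gibbsState β (xyzRealFieldHamiltonian (d := d) (N * b) n (s₁ ^ 2) (-(s₂ ^ 2)) 0)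
        (productOp fun x => p (τ (blockOf N b x)) (mirroredOffset hN x))).re| ^ (N ^ d) ≤
      ∏ c, (Matrix.gibbsState β (xyzRealFieldHamiltonian (d := d) (N * b) n (s₁ ^ 2) (-(s₂ ^ 2)) 0)
        (productOp fun y => p (τ c) (mirroredOffset hN y))).re :=
  chessboard_estimate_blocks_gibbs_real hd hN hN1
    (xyzRealFieldHamiltonian_isHermitian (N * b) n _ _ 0)
    (fun i k => xyzReal_isRPExponent (N * b) n (hN.mul_right b) s₁ s₂ hβ i (blockPlane N b k))
    p hp τ

end Blocks

end Literature.MathematicalPhysics.QuantumLattice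

end
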